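import Summits.Ventures.PercRepro.C041PendantCounts
import Summits.Ventures.PercRepro.C041SixVec

/-!
# ROW C-041 — THEOREM (PENDANT ZONE) IN SIX-VECTOR FORM: `Π(Z₁ ∪_u Z₂) = x·ℓ(ψΠ₂) + z·Π₂ + w·n′·𝟙`, and the cone
is closed under pendant attachment (p6, gen 29; mine-3's C-041.md §20 (b))

Setting of `C041PendantCounts`: the glued zone `pendant Z₁ u Z₂ a₂` (an unmarked multigraph `Z₁` with anchor `a`, a
zone `Z₂` hung at `u`).  THE FOUR CLASSES of colourings of `Z₁` — `u` merged and not reached (`xCount`), reached and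
not merged (`yCount`), both (`zCount`), neither (`wCount`) — with `x = y` by the complementation involution
(`xCount_eq_yCount`).  Every count of the glued zone splits over the four classes (`card_four_classes`), and the six
counts read: the merged-unreached class contributes `Z₂`'s `(F, F+T₁, F+T₂, F, F+T₁, F+T₂)` (everything invalid,
`K` never enters `Z₂`), the separated-reached class `(n′, n′, n′, I, I, I)` (`u`'s sub-zone is a separate admissible
sub-zone, invalid iff `Z₂` is), the merged-reached class `Π(Z₂)` itself, and the rest `n′·𝟙`
(`sixVec_pendant`).  With `x = y` the first two add up to `ℓ(ψ Π(Z₂))`, so **cone membership of `Π(Z₂)` gives cone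
membership of `Π(Z₁ ∪_u Z₂)`** (`inCone_sixVec_pendant`, by mine-3's decomposition lemma `InCone.mul_ell`) — the
pendant step of the class 𝒵 of §20 (b)(3) in the six-vector form that also carries the gluing at the anchor
(`C041AnchorGlueSix`).
-/

namespace PercRepro

namespace ZoneZ

namespace Pendant

open ZoneData TreeClosure Finset

universe u₁ u₂ u₃ u₄ u₅ u₆ u₇ u₈

variable {V₁ : Type u₁} {E₁ : Type u₂} {U₁ : Type u₃} {U₂ : Type u₄} {V₂ : Type u₅} {E₂ : Type u₆}
  {T₁ : Type u₇} {T₂ : Type u₈}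
variable (Z₁ : ZoneData V₁ E₁ U₁ U₂) (u : V₁) (Z₂ : ZoneData V₂ E₂ T₁ T₂) (a₂ : V₂) (a : V₁)

/-! ## The four classes of colourings of `Z₁` -/

section Classes

variable [Fintype E₁] [DecidableEq E₁]

open Classical in
/-- `x`: `u` merged into the anchor's blue sub-zone and not reached by its red reach. -/
noncomputable def xCount : ℕ := #(univ.filter fun ω : E₁ → Bool => Z₁.Mg a u ω ∧ ¬ Z₁.Rd a u ω)

open Classical in
/-- `y`: `u` reached and not merged. -/
noncomputable def yCount : ℕ := #(univ.filter fun ω : E₁ → Bool => ¬ Z₁.Mg a u ω ∧ Z₁.Rd a u ω)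

open Classical in
/-- `z`: `u` merged and reached (impossible on a tree — the cycle class). -/
noncomputable def zCount : ℕ := #(univ.filter fun ω : E₁ → Bool => Z₁.Mg a u ω ∧ Z₁.Rd a u ω)

open Classical in
/-- `w`: `u` neither merged nor reached. -/
noncomputable def wCount : ℕ := #(univ.filter fun ω : E₁ → Bool => ¬ Z₁.Mg a u ω ∧ ¬ Z₁.Rd a u ω)

/-- **Complementation**: `x = y`. -/
theorem xCount_eq_yCount : xCount Z₁ u a = yCount Z₁ u a := by
  classical
  unfold xCount yCount
  refine card_eq_of_involutive cpl cpl_cpl ?_ ?_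
  · intro ω hω
    rw [Finset.mem_filter] at hω ⊢
    exact ⟨Finset.mem_univ _, fun h => hω.2.2 ((Z₁.Mg_cpl a u ω).1 h), (Z₁.Rd_cpl a u ω).2 hω.2.1⟩
  · intro ω hω
    rw [Finset.mem_filter] at hω ⊢
    exact ⟨Finset.mem_univ _, (Z₁.Mg_cpl a u ω).2 hω.2.2, fun h => hω.2.1 ((Z₁.Rd_cpl a u ω).1 h)⟩

end Classes

/-! ## Counting over the four classes -/

section Counts

open Classical

variable [Fintype E₁] [DecidableEq E₁] [Fintype E₂] [DecidableEq E₂] [Fintype T₁] [DecidableEq T₁]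
  [Fintype T₂] [DecidableEq T₂]

/-- A count on pairs which, on each class of the colouring, is a condition on the `Z₂`-state, splits as
`x·#P_B + y·#P_R + z·#P_X + w·#P_W`. -/
theorem card_four_classes (Q : (E₁ → Bool) × State E₂ T₁ T₂ → Prop) [DecidablePred Q]
    (PB PR PX PW : State E₂ T₁ T₂ → Prop) [DecidablePred PB] [DecidablePred PR] [DecidablePred PX]
    [DecidablePred PW]
    (hQ : ∀ p, Q p ↔ (Z₁.Mg a u p.1 ∧ ¬ Z₁.Rd a u p.1 → PB p.2) ∧ (¬ Z₁.Mg a u p.1 ∧ Z₁.Rd a u p.1 → PR p.2) ∧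
      (Z₁.Mg a u p.1 ∧ Z₁.Rd a u p.1 → PX p.2) ∧ (¬ Z₁.Mg a u p.1 ∧ ¬ Z₁.Rd a u p.1 → PW p.2)) :
    #((univ : Finset ((E₁ → Bool) × State E₂ T₁ T₂)).filter Q) =
      xCount Z₁ u a * #(univ.filter PB) + yCount Z₁ u a * #(univ.filter PR) +
        zCount Z₁ u a * #(univ.filter PX) + wCount Z₁ u a * #(univ.filter PW) := by
  have h1 := Finset.card_filter_add_card_filter_not (s := (univ : Finset ((E₁ → Bool) × State E₂ T₁ T₂)).filter Q)
    fun p => Z₁.Mg a u p.1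
  have h2 := Finset.card_filter_add_card_filter_not
    (s := ((univ : Finset ((E₁ → Bool) × State E₂ T₁ T₂)).filter Q).filter fun p => Z₁.Mg a u p.1)
    fun p => Z₁.Rd a u p.1
  have h3 := Finset.card_filter_add_card_filter_not
    (s := ((univ : Finset ((E₁ → Bool) × State E₂ T₁ T₂)).filter Q).filter fun p => ¬ Z₁.Mg a u p.1)
    fun p => Z₁.Rd a u p.1
  have eX : (((univ : Finset ((E₁ → Bool) × State E₂ T₁ T₂)).filter Q).filter fun p => Z₁.Mg a u p.1).filter
      (fun p => Z₁.Rd a u p.1) =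
      univ.filter fun p : (E₁ → Bool) × State E₂ T₁ T₂ => (Z₁.Mg a u p.1 ∧ Z₁.Rd a u p.1) ∧ PX p.2 := by
    ext p
    simp only [Finset.mem_filter, Finset.mem_univ, true_and, hQ]
    tauto
  have eB : (((univ : Finset ((E₁ → Bool) × State E₂ T₁ T₂)).filter Q).filter fun p => Z₁.Mg a u p.1).filter
      (fun p => ¬ Z₁.Rd a u p.1) =
      univ.filter fun p : (E₁ → Bool) × State E₂ T₁ T₂ => (Z₁.Mg a u p.1 ∧ ¬ Z₁.Rd a u p.1) ∧ PB p.2 := by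
    ext p
    simp only [Finset.mem_filter, Finset.mem_univ, true_and, hQ]
    tauto
  have eR : (((univ : Finset ((E₁ → Bool) × State E₂ T₁ T₂)).filter Q).filter fun p => ¬ Z₁.Mg a u p.1).filter
      (fun p => Z₁.Rd a u p.1) =
      univ.filter fun p : (E₁ → Bool) × State E₂ T₁ T₂ => (¬ Z₁.Mg a u p.1 ∧ Z₁.Rd a u p.1) ∧ PR p.2 := by
    ext p
    simp only [Finset.mem_filter, Finset.mem_univ, true_and, hQ]
    tauto
  have eW : (((univ : Finset ((E₁ → Bool) × State E₂ T₁ T₂)).filter Q).filter fun p => ¬ Z₁.Mg a u p.1).filter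
      (fun p => ¬ Z₁.Rd a u p.1) =
      univ.filter fun p : (E₁ → Bool) × State E₂ T₁ T₂ => (¬ Z₁.Mg a u p.1 ∧ ¬ Z₁.Rd a u p.1) ∧ PW p.2 := by
    ext p
    simp only [Finset.mem_filter, Finset.mem_univ, true_and, hQ]
    tauto
  rw [eX, eB, card_filter_prod (fun ω => Z₁.Mg a u ω ∧ Z₁.Rd a u ω) PX,
    card_filter_prod (fun ω => Z₁.Mg a u ω ∧ ¬ Z₁.Rd a u ω) PB] at h2
  rw [eR, eW, card_filter_prod (fun ω => ¬ Z₁.Mg a u ω ∧ Z₁.Rd a u ω) PR,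
    card_filter_prod (fun ω => ¬ Z₁.Mg a u ω ∧ ¬ Z₁.Rd a u ω) PW] at h3
  unfold xCount yCount zCount wCount
  omega

/-- A count of the glued zone, through the pairs and the four classes. -/
theorem card_glued_four (Q : State (E₁ ⊕ E₂) T₁ T₂ → Prop) [DecidablePred Q]
    (PB PR PX PW : State E₂ T₁ T₂ → Prop) [DecidablePred PB] [DecidablePred PR] [DecidablePred PX]
    [DecidablePred PW]
    (h : ∀ σ, Q σ ↔ (Z₁.Mg a u (colL σ) ∧ ¬ Z₁.Rd a u (colL σ) → PB (restr σ)) ∧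
      (¬ Z₁.Mg a u (colL σ) ∧ Z₁.Rd a u (colL σ) → PR (restr σ)) ∧
      (Z₁.Mg a u (colL σ) ∧ Z₁.Rd a u (colL σ) → PX (restr σ)) ∧
      (¬ Z₁.Mg a u (colL σ) ∧ ¬ Z₁.Rd a u (colL σ) → PW (restr σ))) :
    #(univ.filter Q) = xCount Z₁ u a * #(univ.filter PB) + yCount Z₁ u a * #(univ.filter PR) +
      zCount Z₁ u a * #(univ.filter PX) + wCount Z₁ u a * #(univ.filter PW) := by
  rw [← card_four_classes Z₁ u a (fun p => (Z₁.Mg a u p.1 ∧ ¬ Z₁.Rd a u p.1 → PB p.2) ∧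
    (¬ Z₁.Mg a u p.1 ∧ Z₁.Rd a u p.1 → PR p.2) ∧ (Z₁.Mg a u p.1 ∧ Z₁.Rd a u p.1 → PX p.2) ∧
    (¬ Z₁.Mg a u p.1 ∧ ¬ Z₁.Rd a u p.1 → PW p.2)) PB PR PX PW (fun _ => Iff.rfl)]
  exact card_filter_eq Q (fun p => (Z₁.Mg a u p.1 ∧ ¬ Z₁.Rd a u p.1 → PB p.2) ∧
    (¬ Z₁.Mg a u p.1 ∧ Z₁.Rd a u p.1 → PR p.2) ∧ (Z₁.Mg a u p.1 ∧ Z₁.Rd a u p.1 → PX p.2) ∧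
    (¬ Z₁.Mg a u p.1 ∧ ¬ Z₁.Rd a u p.1 → PW p.2)) h

/-- The six count sets of `Z₂`, as filters (for the dictionary below). -/
theorem filters_Z₂ :
    Z₂.Fset a₂ = univ.filter (fun τ => Z₂.adm τ ∧ a₂ ∉ Z₂.D τ ∧ a₂ ∉ Z₂.D2 τ) ∧
    Z₂.FAset a₂ = univ.filter (fun τ => Z₂.adm τ ∧ a₂ ∉ Z₂.D2 τ) ∧
    Z₂.FBset a₂ = univ.filter (fun τ => Z₂.adm τ ∧ a₂ ∉ Z₂.D τ) ∧
    Z₂.IFset a₂ = univ.filter (fun τ => Z₂.adm τ ∧ Z₂.blueK {a₂} τ ∧ a₂ ∉ Z₂.D τ ∧ a₂ ∉ Z₂.D2 τ) ∧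
    Z₂.IAset a₂ = univ.filter (fun τ => Z₂.adm τ ∧ Z₂.blueK {a₂} τ ∧ a₂ ∉ Z₂.D2 τ) ∧
    Z₂.IBset a₂ = univ.filter (fun τ => Z₂.adm τ ∧ Z₂.blueK {a₂} τ ∧ a₂ ∉ Z₂.D τ) ∧
    Z₂.Iset a₂ = univ.filter (fun τ => Z₂.adm τ ∧ Z₂.blueK {a₂} τ) ∧
    Z₂.Aset (∅ : Set V₂) = univ.filter (fun τ => Z₂.adm τ) := by
  classical
  refine ⟨?_, ?_, ?_, ?_, ?_, ?_, ?_, ?_⟩ <;> ext τ <;>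
    simp only [mem_Fset, mem_FAset, mem_FBset, mem_IFset, mem_IAset, mem_IBset, mem_Iset, mem_Aset_empty,
      Finset.mem_filter, Finset.mem_univ, true_and]

set_option linter.unusedSimpArgs false in
/-- `#F` of the glued zone over the four classes. -/
theorem card_Fset_four :
    #((pendant Z₁ u Z₂ a₂).Fset (Sum.inl a)) = xCount Z₁ u a * #(Z₂.Fset a₂) + yCount Z₁ u a * #(Z₂.Aset ∅) +
      zCount Z₁ u a * #(Z₂.Fset a₂) + wCount Z₁ u a * #(Z₂.Aset ∅) := by
  classical
  obtain ⟨eF, -, -, -, -, -, -, eN⟩ := filters_Z₂ Z₂ a₂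
  have e : (pendant Z₁ u Z₂ a₂).Fset (Sum.inl a) = univ.filter fun σ => (pendant Z₁ u Z₂ a₂).adm σ ∧
      Sum.inl a ∉ (pendant Z₁ u Z₂ a₂).D σ ∧ Sum.inl a ∉ (pendant Z₁ u Z₂ a₂).D2 σ := by
    ext σ
    rw [mem_Fset, Finset.mem_filter]
    simp only [Finset.mem_univ, true_and]
  rw [e, eF, eN]
  refine card_glued_four Z₁ u a _ _ _ _ _ fun σ => ?_
  rw [adm_iff, inl_a_mem_D_iff, inl_a_mem_D2_iff]
  rcases Classical.em (Z₁.Mg a u (colL σ)) with hM | hM <;> rcases Classical.em (Z₁.Rd a u (colL σ)) with hR | hR <;>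
    simp only [hM, hR, true_and, and_true, false_and, and_false, not_true_eq_false, not_false_eq_true,
      true_implies, false_implies, and_self, not_and, imp_false, true_or, or_true, false_or, or_false]

set_option linter.unusedSimpArgs false in
/-- `#(F + T₁)` of the glued zone over the four classes. -/
theorem card_FAset_four :
    #((pendant Z₁ u Z₂ a₂).FAset (Sum.inl a)) = xCount Z₁ u a * #(Z₂.FAset a₂) + yCount Z₁ u a * #(Z₂.Aset ∅) +
      zCount Z₁ u a * #(Z₂.FAset a₂) + wCount Z₁ u a * #(Z₂.Aset ∅) := by
  classical
  obtain ⟨-, eA, -, -, -, -, -, eN⟩ := filters_Z₂ Z₂ a₂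
  have e : (pendant Z₁ u Z₂ a₂).FAset (Sum.inl a) = univ.filter fun σ => (pendant Z₁ u Z₂ a₂).adm σ ∧
      Sum.inl a ∉ (pendant Z₁ u Z₂ a₂).D2 σ := by
    ext σ
    rw [mem_FAset, Finset.mem_filter]
    simp only [Finset.mem_univ, true_and]
  rw [e, eA, eN]
  refine card_glued_four Z₁ u a _ _ _ _ _ fun σ => ?_
  rw [adm_iff, inl_a_mem_D2_iff]
  rcases Classical.em (Z₁.Mg a u (colL σ)) with hM | hM <;> rcases Classical.em (Z₁.Rd a u (colL σ)) with hR | hR <;>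
    simp only [hM, hR, true_and, and_true, false_and, and_false, not_true_eq_false, not_false_eq_true,
      true_implies, false_implies, and_self, not_and, imp_false, true_or, or_true, false_or, or_false]

set_option linter.unusedSimpArgs false in
/-- `#(F + T₂)` of the glued zone over the four classes. -/
theorem card_FBset_four :
    #((pendant Z₁ u Z₂ a₂).FBset (Sum.inl a)) = xCount Z₁ u a * #(Z₂.FBset a₂) + yCount Z₁ u a * #(Z₂.Aset ∅) +
      zCount Z₁ u a * #(Z₂.FBset a₂) + wCount Z₁ u a * #(Z₂.Aset ∅) := by
  classical
  obtain ⟨-, -, eB, -, -, -, -, eN⟩ := filters_Z₂ Z₂ a₂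
  have e : (pendant Z₁ u Z₂ a₂).FBset (Sum.inl a) = univ.filter fun σ => (pendant Z₁ u Z₂ a₂).adm σ ∧
      Sum.inl a ∉ (pendant Z₁ u Z₂ a₂).D σ := by
    ext σ
    rw [mem_FBset, Finset.mem_filter]
    simp only [Finset.mem_univ, true_and]
  rw [e, eB, eN]
  refine card_glued_four Z₁ u a _ _ _ _ _ fun σ => ?_
  rw [adm_iff, inl_a_mem_D_iff]
  rcases Classical.em (Z₁.Mg a u (colL σ)) with hM | hM <;> rcases Classical.em (Z₁.Rd a u (colL σ)) with hR | hR <;>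
    simp only [hM, hR, true_and, and_true, false_and, and_false, not_true_eq_false, not_false_eq_true,
      true_implies, false_implies, and_self, not_and, imp_false, true_or, or_true, false_or, or_false]

set_option linter.unusedSimpArgs false in
/-- `#I_F` of the glued zone over the four classes. -/
theorem card_IFset_four :
    #((pendant Z₁ u Z₂ a₂).IFset (Sum.inl a)) = xCount Z₁ u a * #(Z₂.Fset a₂) + yCount Z₁ u a * #(Z₂.Iset a₂) +
      zCount Z₁ u a * #(Z₂.IFset a₂) + wCount Z₁ u a * #(Z₂.Aset ∅) := by
  classical
  obtain ⟨eF, -, -, eIF, -, -, eI, eN⟩ := filters_Z₂ Z₂ a₂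
  have e : (pendant Z₁ u Z₂ a₂).IFset (Sum.inl a) = univ.filter fun σ => (pendant Z₁ u Z₂ a₂).adm σ ∧
      (pendant Z₁ u Z₂ a₂).blueK {Sum.inl a} σ ∧ Sum.inl a ∉ (pendant Z₁ u Z₂ a₂).D σ ∧
        Sum.inl a ∉ (pendant Z₁ u Z₂ a₂).D2 σ := by
    ext σ
    rw [mem_IFset, Finset.mem_filter]
    simp only [Finset.mem_univ, true_and]
  rw [e, eF, eIF, eI, eN]
  refine card_glued_four Z₁ u a _ _ _ _ _ fun σ => ?_
  rw [adm_iff, blueK_iff, inl_a_mem_D_iff, inl_a_mem_D2_iff]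
  rcases Classical.em (Z₁.Mg a u (colL σ)) with hM | hM <;> rcases Classical.em (Z₁.Rd a u (colL σ)) with hR | hR <;>
    simp only [hM, hR, true_and, and_true, false_and, and_false, not_true_eq_false, not_false_eq_true,
      true_implies, false_implies, and_self, not_and, imp_false, true_or, or_true, false_or, or_false]

set_option linter.unusedSimpArgs false in
/-- `#(I_F + I₁)` of the glued zone over the four classes. -/
theorem card_IAset_four :
    #((pendant Z₁ u Z₂ a₂).IAset (Sum.inl a)) = xCount Z₁ u a * #(Z₂.FAset a₂) + yCount Z₁ u a * #(Z₂.Iset a₂) +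
      zCount Z₁ u a * #(Z₂.IAset a₂) + wCount Z₁ u a * #(Z₂.Aset ∅) := by
  classical
  obtain ⟨-, eA, -, -, eIA, -, eI, eN⟩ := filters_Z₂ Z₂ a₂
  have e : (pendant Z₁ u Z₂ a₂).IAset (Sum.inl a) = univ.filter fun σ => (pendant Z₁ u Z₂ a₂).adm σ ∧
      (pendant Z₁ u Z₂ a₂).blueK {Sum.inl a} σ ∧ Sum.inl a ∉ (pendant Z₁ u Z₂ a₂).D2 σ := by
    ext σ
    rw [mem_IAset, Finset.mem_filter]
    simp only [Finset.mem_univ, true_and]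
  rw [e, eA, eIA, eI, eN]
  refine card_glued_four Z₁ u a _ _ _ _ _ fun σ => ?_
  rw [adm_iff, blueK_iff, inl_a_mem_D2_iff]
  rcases Classical.em (Z₁.Mg a u (colL σ)) with hM | hM <;> rcases Classical.em (Z₁.Rd a u (colL σ)) with hR | hR <;>
    simp only [hM, hR, true_and, and_true, false_and, and_false, not_true_eq_false, not_false_eq_true,
      true_implies, false_implies, and_self, not_and, imp_false, true_or, or_true, false_or, or_false]

set_option linter.unusedSimpArgs false in
/-- `#(I_F + I₂)` of the glued zone over the four classes. -/
theorem card_IBset_four :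
    #((pendant Z₁ u Z₂ a₂).IBset (Sum.inl a)) = xCount Z₁ u a * #(Z₂.FBset a₂) + yCount Z₁ u a * #(Z₂.Iset a₂) +
      zCount Z₁ u a * #(Z₂.IBset a₂) + wCount Z₁ u a * #(Z₂.Aset ∅) := by
  classical
  obtain ⟨-, -, eB, -, -, eIB, eI, eN⟩ := filters_Z₂ Z₂ a₂
  have e : (pendant Z₁ u Z₂ a₂).IBset (Sum.inl a) = univ.filter fun σ => (pendant Z₁ u Z₂ a₂).adm σ ∧
      (pendant Z₁ u Z₂ a₂).blueK {Sum.inl a} σ ∧ Sum.inl a ∉ (pendant Z₁ u Z₂ a₂).D σ := by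
    ext σ
    rw [mem_IBset, Finset.mem_filter]
    simp only [Finset.mem_univ, true_and]
  rw [e, eB, eIB, eI, eN]
  refine card_glued_four Z₁ u a _ _ _ _ _ fun σ => ?_
  rw [adm_iff, blueK_iff, inl_a_mem_D_iff]
  rcases Classical.em (Z₁.Mg a u (colL σ)) with hM | hM <;> rcases Classical.em (Z₁.Rd a u (colL σ)) with hR | hR <;>
    simp only [hM, hR, true_and, and_true, false_and, and_false, not_true_eq_false, not_false_eq_true,
      true_implies, false_implies, and_self, not_and, imp_false, true_or, or_true, false_or, or_false]

end Counts

end Pendant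

end ZoneZ

end PercRepro
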